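import Mathlib.Analysis.InnerProductSpace.LinearMap
import Mathlib.Analysis.Normed.Operator.BoundedLinearMaps
import Mathlib.Topology.EMetricSpace.Paracompact
import Mathlib.Topology.Metrizable.Uniformity
import Literature.AlgebraicTopology.CharacteristicClasses.TautologicalLineCore
import HarnessLib

/-!
# The projective space of an inner product space is metrizable, hence paracompact

Topic `Literature/AlgebraicTopology/CharacteristicClasses`. For a complex inner product space `H`
(any dimension), the quotient topology of `ℙ ℂ H` (`Projectivization.instTopologicalSpace`) is
metrizable: the map `Φ : [v] ↦ P_v = ‖v‖⁻² ⟨v, ·⟩ v` to the rank-one projections, in the normed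
space of bounded operators, is a topological embedding (`isEmbedding_lineProjection`). Continuity
is read through the quotient map; injectivity since `P_v` has range the line; and `Φ` is INDUCING
because for unit vectors `(P_w - P_v) v = ⟨w, v⟩ w - v`, so `‖P_w - P_v‖ < ε` exhibits the
representative `⟨w, v⟩ w` of `[w]` within `ε` of `v` — the quotient topology is the Fubini–Study
(operator-norm, or gap) metric topology (folklore; e.g. the metric `d(L, L') = ‖P_L - P_{L'}‖` on
the projective space / Grassmannian of a Hilbert space). Consequently `ℙ ℂ H` is paracompact
(metric spaces are paracompact, `EMetric.instParacompactSpace`), which the axioms of Chern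
classes (`ChernClassTheory`: naturality over paracompact Hausdorff bases) require of the
classifying space `ℙ(ℓ²)` of line bundles (Husemoller, *Fibre Bundles*, Ch. 3 §7, Ch. 17 §3;
CW-models of `ℂP^∞` are paracompact by Miyazaki's theorem, here replaced by the Hilbert model).

## Content (all proved)

* `lineProjection : ℙ ℂ H → (H →L[ℂ] H)`, `lineProjection_mk`, continuity, injectivity;
* `isEmbedding_lineProjection`;
* instances `metrizableSpace_projectivization`, `paracompactSpace_projectivization`.

## References

* [HusemollerFibreBundles1994] D. Husemoller, *Fibre Bundles*, 3rd ed. (1994), Ch. 3 §7 (the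
  classifying space `P^∞`), Ch. 17 (2.4) (paracompactness assumptions).
-/

noncomputable section

open Function Set Filter Topology ComplexConjugate
open scoped LinearAlgebra.Projectivization InnerProductSpace

universe u

namespace Literature.AlgebraicTopology.CharacteristicClasses

variable {H : Type u} [NormedAddCommGroup H] [InnerProductSpace ℂ H]

/-- The rank-one operator `P(v) = ‖v‖⁻² ⟨v, ·⟩ v` of a vector (the orthogonal projection onto
`ℂ v` when `v ≠ 0`). [folklore] -/
def vecProjection (v : H) : H →L[ℂ] H :=
  ((‖v‖ ^ 2 : ℝ) : ℂ)⁻¹ • (innerSL ℂ v).smulRight v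

/-- `P(v) w = ‖v‖⁻² ⟨v, w⟩ v`. [folklore] -/
@[simp]
theorem vecProjection_apply (v w : H) :
    vecProjection v w = ((‖v‖ ^ 2 : ℝ) : ℂ)⁻¹ • (⟪v, w⟫_ℂ • v) := rfl

/-- `P(c v) = P(v)` for `c ≠ 0`. [folklore] -/
theorem vecProjection_smul {c : ℂ} (hc : c ≠ 0) (v : H) : vecProjection (c • v) = vecProjection v := by
  ext w
  rw [vecProjection_apply, vecProjection_apply, inner_smul_left, norm_smul, mul_pow,
    Complex.ofReal_mul, mul_inv, smul_smul, smul_smul, smul_smul]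
  congr 1
  have hc2 : ((‖c‖ ^ 2 : ℝ) : ℂ) = conj c * c := by
    rw [Complex.conj_mul']
    push_cast
    ring
  rw [hc2]
  field_simp [(map_ne_zero _).2 hc, hc]

/-- `P` is continuous on `H`. [folklore] -/
theorem continuousOn_vecProjection : ContinuousOn (vecProjection : H → H →L[ℂ] H) {v | v ≠ 0} := by
  have h0 : Continuous fun v : H ↦ ((‖v‖ ^ 2 : ℝ) : ℂ) := by fun_prop
  have h1 : ContinuousOn (fun v : H ↦ ((‖v‖ ^ 2 : ℝ) : ℂ)⁻¹) {v | v ≠ 0} := by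
    refine h0.continuousOn.inv₀ fun v hv ↦ ?_
    exact_mod_cast pow_ne_zero 2 (norm_ne_zero_iff.2 hv)
  have h2 : Continuous (fun v : H ↦ (innerSL ℂ v).smulRight v) :=
    (isBoundedBilinearMap_smulRight (𝕜 := ℂ) (E := H) (F := H)).continuous.comp
      ((innerSL ℂ).continuous.prodMk continuous_id)
  exact h1.smul h2.continuousOn

/-- **The rank-one projection of a line**, `[v] ↦ P_v = ‖v‖⁻² ⟨v, ·⟩ v`, a map
`ℙ ℂ H → (H →L[ℂ] H)` (well defined: `P(c v) = P(v)`). [folklore] -/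
def lineProjection : ℙ ℂ H → H →L[ℂ] H :=
  Projectivization.lift (fun v : {v : H // v ≠ 0} ↦ vecProjection (v : H)) (by
    rintro ⟨v, hv⟩ ⟨w, hw⟩ t (rfl : v = t • w)
    have ht : t ≠ 0 := by rintro rfl; exact hv (zero_smul ℂ w)
    exact vecProjection_smul ht w)

/-- `lineProjection [v] = P(v)`. [folklore] -/
@[simp]
theorem lineProjection_mk (v : H) (hv : v ≠ 0) :
    lineProjection (Projectivization.mk ℂ v hv) = vecProjection v := rfl

/-- `lineProjection` is continuous. [folklore] -/
theorem continuous_lineProjection : Continuous (lineProjection : ℙ ℂ H → H →L[ℂ] H) := by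
  rw [continuous_iff_comp_mk']
  exact continuousOn_vecProjection.comp_continuous continuous_subtype_val fun v ↦ v.2

/-- On a unit vector `v`, `P(v) v = v`. [folklore] -/
theorem vecProjection_self {v : H} (hv : ‖v‖ = 1) : vecProjection v v = v := by
  rw [vecProjection_apply, inner_self_eq_norm_sq_to_K, hv]
  simp

/-- On a unit vector `w`, `P(w) v = ⟨w, v⟩ w`. [folklore] -/
theorem vecProjection_apply_of_norm_eq_one {w : H} (hw : ‖w‖ = 1) (v : H) :
    vecProjection w v = ⟪w, v⟫_ℂ • w := by
  rw [vecProjection_apply, hw]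
  simp

/-- Every point of `ℙ ℂ H` is the class of a unit vector. [folklore] -/
theorem exists_norm_eq_one_mk_eq (p : ℙ ℂ H) :
    ∃ (u : H) (hu : ‖u‖ = 1), Projectivization.mk ℂ u (by rintro rfl; simp at hu) = p := by
  induction p with
  | h v hv =>
    refine ⟨(‖v‖ : ℂ)⁻¹ • v, norm_smul_inv_norm hv, ?_⟩
    exact (Projectivization.mk_eq_mk_iff' ℂ _ _ _ hv).2 ⟨(‖v‖ : ℂ)⁻¹, rfl⟩

/-- **Key estimate**: for unit `v, w`, the representative `⟨w, v⟩ w` of `[w]` is within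
`‖P_w - P_v‖` of `v`. [folklore] -/
theorem norm_inner_smul_sub_le {v w : H} (hv : ‖v‖ = 1) (hw : ‖w‖ = 1) :
    ‖⟪w, v⟫_ℂ • w - v‖ ≤ ‖vecProjection w - vecProjection v‖ := by
  have h : (vecProjection w - vecProjection v) v = ⟪w, v⟫_ℂ • w - v := by
    rw [show (vecProjection w - vecProjection v) v = vecProjection w v - vecProjection v v from rfl,
      vecProjection_apply_of_norm_eq_one hw, vecProjection_self hv]
  rw [← h]
  simpa [hv] using (vecProjection w - vecProjection v).le_opNorm v

/-- `lineProjection` is injective: `P_v = P_w` forces `v ∈ ℂ w`. [folklore] -/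
theorem injective_lineProjection : Injective (lineProjection : ℙ ℂ H → H →L[ℂ] H) := by
  intro p q hpq
  obtain ⟨v, hv, rfl⟩ := exists_norm_eq_one_mk_eq p
  obtain ⟨w, hw, rfl⟩ := exists_norm_eq_one_mk_eq q
  rw [lineProjection_mk, lineProjection_mk] at hpq
  have h := norm_inner_smul_sub_le hv hw
  rw [hpq, sub_self, norm_zero, norm_le_zero_iff, sub_eq_zero] at h
  exact (Projectivization.mk_eq_mk_iff' ℂ _ _ _ _).2 ⟨⟪w, v⟫_ℂ, h⟩

/-- **`lineProjection` is a topological embedding** of `ℙ ℂ H` (quotient topology) into the bounded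
operators: the quotient topology is the operator-norm (Fubini–Study) topology. [folklore] -/
theorem isEmbedding_lineProjection : IsEmbedding (lineProjection : ℙ ℂ H → H →L[ℂ] H) := by
  refine ⟨isInducing_iff_nhds.2 fun p ↦ le_antisymm ?_ ?_, injective_lineProjection⟩
  · exact continuous_lineProjection.continuousAt.tendsto.le_comap
  · -- a neighbourhood of `[v]` contains `Φ⁻¹` of an operator-norm ball
    obtain ⟨v, hv, rfl⟩ := exists_norm_eq_one_mk_eq p
    have hv0 : v ≠ 0 := by rintro rfl; simp at hv
    intro U hU
    -- pull `U` back to the non-zero vectors: an open set containing `v`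
    have hU' : (fun w : {v : H // v ≠ 0} ↦ Projectivization.mk ℂ w.1 w.2) ⁻¹' U ∈ 𝓝 ⟨v, hv0⟩ :=
      Projectivization.continuous_mk.continuousAt.preimage_mem_nhds hU
    rw [nhds_subtype_eq_comap, Filter.mem_comap] at hU'
    obtain ⟨S, hS, hSU⟩ := hU'
    obtain ⟨δ, hδ, hball⟩ := Metric.mem_nhds_iff.1 hS
    rw [Filter.mem_comap]
    refine ⟨Metric.ball (lineProjection (Projectivization.mk ℂ v hv0)) (min δ 1),
      Metric.ball_mem_nhds _ (lt_min hδ one_pos), fun q hq ↦ ?_⟩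
    obtain ⟨w, hw, rfl⟩ := exists_norm_eq_one_mk_eq q
    rw [mem_preimage, Metric.mem_ball, lineProjection_mk, lineProjection_mk, dist_eq_norm] at hq
    have hlt : ‖⟪w, v⟫_ℂ • w - v‖ < min δ 1 := (norm_inner_smul_sub_le hv hw).trans_lt hq
    -- the representative `⟨w, v⟩ w` of `[w]` lies in the ball, hence in `S`, hence `[w] ∈ U`
    have hne : ⟪w, v⟫_ℂ • w ≠ 0 := by
      intro h0
      rw [h0, zero_sub, norm_neg, hv] at hlt
      exact (lt_min_iff.1 hlt).2.false
    have hmem : (⟨⟪w, v⟫_ℂ • w, hne⟩ : {v : H // v ≠ 0}) ∈ Subtype.val ⁻¹' S :=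
      hball (Metric.mem_ball.2 (by rw [dist_eq_norm]; exact (lt_min_iff.1 hlt).1))
    have hinU := hSU hmem
    rw [mem_preimage] at hinU
    have hc : ⟪w, v⟫_ℂ ≠ 0 := fun h ↦ hne (by rw [h, zero_smul])
    rwa [show Projectivization.mk ℂ (⟪w, v⟫_ℂ • w) hne =
      Projectivization.mk ℂ w (by rintro rfl; simp at hw) from
        (Projectivization.mk_eq_mk_iff' ℂ _ _ _ _).2 ⟨⟪w, v⟫_ℂ, rfl⟩] at hinU

/-- **The projective space of an inner product space is metrizable** (embedding into the bounded
operators). [folklore] -/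
instance metrizableSpace_projectivization : TopologicalSpace.MetrizableSpace (ℙ ℂ H) :=
  isEmbedding_lineProjection.metrizableSpace

/-- **The projective space of an inner product space is paracompact** (metrizable spaces are
paracompact) — the paracompactness of the Hilbert model `ℙ(ℓ²)` of the classifying space `ℂP^∞`
(Husemoller, Ch. 17 (2.4): the constructions of Chern classes are made over paracompact bases).
[cite: HusemollerFibreBundles1994, Ch. 17 (2.4)] -/
instance paracompactSpace_projectivization : ParacompactSpace (ℙ ℂ H) :=
  letI : PseudoMetricSpace (ℙ ℂ H) := TopologicalSpace.pseudoMetrizableSpacePseudoMetric _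
  inferInstance

end Literature.AlgebraicTopology.CharacteristicClasses
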